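import Summits.Ventures.Crystal3D.Theorems.StickyWulffConstantCoaxialWallLawEndStar
import Summits.Ventures.Crystal3D.Theorems.StickyWulffConstantCoaxialWallLawEndGap
import HarnessLib

/-!
# Exact end accounting for the word automaton, III: a reachable END has at most eleven contacts (full, cross AND glide targets)

HONEST FRAMING. Part of the venture `Summits/Ventures/Crystal3D` (cell `crystal3d-full`), helper for the crux
`CoaxialWallLaw` (stmt-Ventures-19481) of `route-Ventures-StickyWulffConstant`, REGISTERED line `WallLedgerF`
(planner cf-p1 gen 16), open stub `stub_coaxialTwoSlabAdhesion` (general fillings).  Rung credit only; F-C1 not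
moved.  Third brick of the EXACT END ACCOUNTING (memo F-FRONTIER-g5 §4(b); `…EndGap`, `…ExactCount`): the
reachable ends handed over by `word_sources_le_exact` are charged to their OWN ball.  `…EndStar` did this for the
targets of FULL and CROSS moves (they carry the closed `C12` vertex star of the arrival slot; E1 row C12-55,
`ExactOnly 0 (star s₀)`, BY NAME); this file adds the targets of GLIDE moves, which carry the closed EQUATORIAL
vertex star of the twin dozen (`A12`: the reading ball `b − F κ u`, the two own equatorial neighbours, the own
polar neighbour below the composition plane and its mirror image above it — the `C12` star has the fcc ball above
instead, which is EMPTY at a glide target), and packages the conclusion for the count: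

* `le_eleven_or_moving_of_exactOnly` — pattern-free form of `…EndStar`'s `le_eleven_or_moving_of_closedStar`: any
  exact-only own pattern `O ⊆ N(e)`, a predecessor `e − A u ∈ X` and three independent occupied slots give
  «`≤ 11` contacts, or a full `A`-shell, or a twin reading across `n` with `⟪A u, n⟫ ∈ {√(2/3), 0}`» (the value
  `−√(2/3)` would make `−u` an empty far slot).
* `word_target_glide_star` — after a GLIDE (`⟪d κ, m⟫ = 0` at a twin reading `(κ, m)` of `y`) the target
  `b = y + d κ` has: `b − F κ u ∈ X`; `b + F κ s ∈ X` for every slot `s` with `⟪s, u⟫ = −½` and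
  `⟪F κ (u + s), m⟫ ≤ 0`; `b + (F κ s − 2⟪F κ s, m⟫ m) ∈ X` for those with `⟪F κ (u + s), m⟫ < 0` (the GLIDE STAR).
* **`word_reachable_end_le_eleven`** — given the two E1 rows BY NAME (`hcert`: C12-55 as in `…EndStar`;
  `hcertA`: the glide star is exact-only, stated for every frame, normal, slot and centre — one `A12` row up to the
  symmetries `ExactOnly.image`), a state `f v` reached from a MOVING state `v ∈ W` that is itself NOT moving has at
  most ELEVEN contacts.  So in the exact count every reachable end pays `½` of deficiency AT ITS OWN BALL, and the
  factor `13` of `card_ends_le_mul` disappears; what is left is the number of reachable ends per ball (`…EndGap` and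
  the next brick).

WHAT THIS IS NOT: not the stub; no certificate is proved here (C12-55: cf-p2 R39c; the A12 equatorial star: cf-p2's
P5 family — both certified-computation targets); the per-ball multiplicity and the assembly follow; F-C1 not moved.
-/

noncomputable section

namespace Summit.Ventures.Crystal3D.Theorems

open Summit.Ventures.Crystal3D Finset
open Literature.MathematicalPhysics.StatisticalMechanics (fccStacking)
open scoped InnerProductSpace

variable {X : Finset (EuclideanSpace ℝ (Fin 3))}

open scoped Classical in
/-- **Exit trichotomy from ANY exact-only own pattern.**  `X` `1`-separated, `e ∈ X`... (see the module docstring):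
an exact-only own pattern `O ⊆ N(e)`, the predecessor `e − A u ∈ X` and three linearly independent occupied slots
give: `e` has `≤ 11` contacts, or its twelve `A`-slots are occupied, or it reads as a twin dozen of `(A, n)` with
`⟪A u, n⟫ = √(2/3)` or `= 0`. -/
theorem le_eleven_or_moving_of_exactOnly (hX : ∀ p ∈ X, ∀ q ∈ X, p ≠ q → 1 ≤ dist p q)
    (A : EuclideanSpace ℝ (Fin 3) ≃ₗᵢ[ℝ] EuclideanSpace ℝ (Fin 3)) {e : EuclideanSpace ℝ (Fin 3)}
    {O : Finset (EuclideanSpace ℝ (Fin 3))} (hOsub : O ⊆ X.filter fun q => dist e q = 1) (hO : ExactOnly e O)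
    {u : EuclideanSpace ℝ (Fin 3)} (hu : u ∈ fccSlots) (hd : e - A u ∈ X)
    {w₁ w₂ w₃ : EuclideanSpace ℝ (Fin 3)} (hw₁ : w₁ ∈ fccSlots) (hw₂ : w₂ ∈ fccSlots) (hw₃ : w₃ ∈ fccSlots)
    (h₁ : e + A w₁ ∈ X) (h₂ : e + A w₂ ∈ X) (h₃ : e + A w₃ ∈ X) (hind : LinearIndependent ℝ ![w₁, w₂, w₃]) :
    (X.filter fun q => dist e q = 1).card ≤ 11 ∨
    (∀ w ∈ fccSlots, e + A w ∈ X) ∨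
    ∃ n : EuclideanSpace ℝ (Fin 3), ‖n‖ = 1 ∧
      (∀ w ∈ fccSlots, ⟪A w, n⟫_ℝ = 0 ∨ ⟪A w, n⟫_ℝ = Real.sqrt (2 / 3) ∨ ⟪A w, n⟫_ℝ = -Real.sqrt (2 / 3)) ∧
      (∀ w ∈ fccSlots, ⟪A w, n⟫_ℝ ≤ 0 → e + A w ∈ X) ∧
      (∀ w ∈ fccSlots, ⟪A w, n⟫_ℝ < 0 → e + (A w - (2 * ⟪A w, n⟫_ℝ) • n) ∈ X) ∧
      (∀ w ∈ fccSlots, 0 < ⟪A w, n⟫_ℝ → e + A w ∉ X) ∧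
      (⟪A u, n⟫_ℝ = Real.sqrt (2 / 3) ∨ ⟪A u, n⟫_ℝ = 0) := by
  rcases trichotomy_of_exactOnly hX A hOsub hO hw₁ hw₂ hw₃ h₁ h₂ h₃ hind with h11 | hall | ⟨n, hn, hmenu, hle, hgt⟩
  · exact Or.inl h11
  · exact Or.inr (Or.inl hall)
  · have hrpos : 0 < Real.sqrt (2 / 3) := Real.sqrt_pos.2 (by norm_num)
    refine Or.inr (Or.inr ⟨n, hn, hmenu, hle, ?_, fun w hw hp => (hgt w hw hp).1, ?_⟩)
    · intro w hw hlt
      have hp : 0 < ⟪A (-w), n⟫_ℝ := by rw [map_neg, inner_neg_left]; linarith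
      have := (hgt (-w) (neg_mem_fccSlots hw) hp).2
      rw [map_neg, inner_neg_left, sub_neg_eq_add] at this
      have e1 : e + (A w - (2 * ⟪A w, n⟫_ℝ) • n) = e + A w + (2 * -⟪A w, n⟫_ℝ) • n := by
        rw [mul_neg, neg_smul]; abel
      rw [e1]; exact this
    · rcases hmenu u hu with h0 | hfar | hneg
      · exact Or.inr h0
      · exact Or.inl hfar
      · exfalso
        have hspos : 0 < ⟪A (-u), n⟫_ℝ := by rw [map_neg, inner_neg_left, hneg, neg_neg]; exact hrpos
        have hmem : e + A (-u) ∈ X := by rw [map_neg, ← sub_eq_add_neg]; exact hd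
        exact (hgt _ (neg_mem_fccSlots hu) hspos).1 hmem

section Word

variable {K : Type*} {F : K → (EuclideanSpace ℝ (Fin 3) ≃ₗᵢ[ℝ] EuclideanSpace ℝ (Fin 3))}
  {d : K → EuclideanSpace ℝ (Fin 3)} {next : K → EuclideanSpace ℝ (Fin 3) → K}
  {W : Finset (EuclideanSpace ℝ (Fin 3) × K)}
  {f : EuclideanSpace ℝ (Fin 3) × K → EuclideanSpace ℝ (Fin 3) × K}

/-- **The target of a GLIDE move carries the glide star** (the closed equatorial vertex star of the twin dozen).
See the module docstring. -/
theorem word_target_glide_star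
    (hf_glide : ∀ v ∈ W, ∀ m : EuclideanSpace ℝ (Fin 3), ‖m‖ = 1 →
      (∀ w ∈ fccSlots, ⟪F v.2 w, m⟫_ℝ = 0 ∨ ⟪F v.2 w, m⟫_ℝ = Real.sqrt (2 / 3) ∨ ⟪F v.2 w, m⟫_ℝ = -Real.sqrt (2 / 3)) →
      (∀ w ∈ fccSlots, ⟪F v.2 w, m⟫_ℝ ≤ 0 → v.1 + F v.2 w ∈ X) →
      (∀ w ∈ fccSlots, ⟪F v.2 w, m⟫_ℝ < 0 → v.1 + (F v.2 w - (2 * ⟪F v.2 w, m⟫_ℝ) • m) ∈ X) →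
      (∀ w ∈ fccSlots, 0 < ⟪F v.2 w, m⟫_ℝ → v.1 + F v.2 w ∉ X) →
      ⟪d v.2, m⟫_ℝ = 0 → f v = (v.1 + d v.2, v.2))
    {v : EuclideanSpace ℝ (Fin 3) × K} (hv : v ∈ W) (hvX : v.1 ∈ X)
    {m : EuclideanSpace ℝ (Fin 3)} (hm : ‖m‖ = 1)
    (hmenu : ∀ w ∈ fccSlots, ⟪F v.2 w, m⟫_ℝ = 0 ∨ ⟪F v.2 w, m⟫_ℝ = Real.sqrt (2 / 3) ∨ ⟪F v.2 w, m⟫_ℝ = -Real.sqrt (2 / 3))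
    (hown : ∀ w ∈ fccSlots, ⟪F v.2 w, m⟫_ℝ ≤ 0 → v.1 + F v.2 w ∈ X)
    (hmir : ∀ w ∈ fccSlots, ⟪F v.2 w, m⟫_ℝ < 0 → v.1 + (F v.2 w - (2 * ⟪F v.2 w, m⟫_ℝ) • m) ∈ X)
    (hfar : ∀ w ∈ fccSlots, 0 < ⟪F v.2 w, m⟫_ℝ → v.1 + F v.2 w ∉ X)
    {u : EuclideanSpace ℝ (Fin 3)} (hu : u ∈ fccSlots) (hdu : d v.2 = F v.2 u) (hdm : ⟪d v.2, m⟫_ℝ = 0) :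
    f v = (v.1 + d v.2, v.2) ∧ (f v).1 - F v.2 u ∈ X ∧
      (∀ s ∈ fccSlots, ⟪s, u⟫_ℝ = -(1 / 2) → ⟪F v.2 (u + s), m⟫_ℝ ≤ 0 → (f v).1 + F v.2 s ∈ X) ∧
      (∀ s ∈ fccSlots, ⟪s, u⟫_ℝ = -(1 / 2) → ⟪F v.2 (u + s), m⟫_ℝ < 0 →
        (f v).1 + (F v.2 s - (2 * ⟪F v.2 s, m⟫_ℝ) • m) ∈ X) := by
  have hfv : f v = (v.1 + d v.2, v.2) := hf_glide v hv m hm hmenu hown hmir hfar hdm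
  have hum : ⟪F v.2 u, m⟫_ℝ = 0 := by rw [← hdu]; exact hdm
  refine ⟨hfv, ?_, ?_, ?_⟩
  · rw [hfv]; simp only; rw [hdu, add_sub_cancel_right]; exact hvX
  · intro s hs hsu hle
    have ht : u + s ∈ fccSlots := add_mem_fccSlots_of_inner_eq_neg_half hu hs (by rw [real_inner_comm]; exact hsu)
    have := hown _ ht hle
    rw [hfv]; simp only
    rw [hdu, add_assoc, ← map_add]; exact this
  · intro s hs hsu hlt
    have ht : u + s ∈ fccSlots := add_mem_fccSlots_of_inner_eq_neg_half hu hs (by rw [real_inner_comm]; exact hsu)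
    have := hmir _ ht hlt
    rw [hfv]; simp only
    have e1 : v.1 + d v.2 + (F v.2 s - (2 * ⟪F v.2 s, m⟫_ℝ) • m) =
        v.1 + (F v.2 (u + s) - (2 * ⟪F v.2 (u + s), m⟫_ℝ) • m) := by
      rw [hdu, map_add, inner_add_left, hum, zero_add]; abel
    rw [e1]; exact this

open scoped Classical in
/-- **A reachable END has at most eleven contacts.**  In the abstract word automaton (`…WordCore` hypotheses
`hd`, `hmirror`, `hdnext`, `hW`, the three move equations), given the E1 rows C12-55 (`hcert`) and the A12 glide
star (`hcertA`) BY NAME: if `v ∈ W` is MOVING (full shell or twin reading) and its target `f v` is NOT moving,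
then the target ball `(f v).1` has at most eleven contacts. -/
theorem word_reachable_end_le_eleven (hX : ∀ p ∈ X, ∀ q ∈ X, p ≠ q → 1 ≤ dist p q)
    {s₀ : EuclideanSpace ℝ (Fin 3)} (hs₀ : s₀ ∈ fccSlots)
    (hcert : ExactOnly 0 (fccSlots.filter fun w => 0 < ⟪w, s₀⟫_ℝ))
    (hcertA : ∀ (A : EuclideanSpace ℝ (Fin 3) ≃ₗᵢ[ℝ] EuclideanSpace ℝ (Fin 3)) (n : EuclideanSpace ℝ (Fin 3)),
      ‖n‖ = 1 → (∀ w ∈ fccSlots, ⟪A w, n⟫_ℝ = 0 ∨ ⟪A w, n⟫_ℝ = Real.sqrt (2 / 3) ∨ ⟪A w, n⟫_ℝ = -Real.sqrt (2 / 3)) →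
      ∀ u ∈ fccSlots, ⟪A u, n⟫_ℝ = 0 → ∀ b : EuclideanSpace ℝ (Fin 3),
      ExactOnly b (insert (b - A u)
        (((fccSlots.filter fun s => ⟪s, u⟫_ℝ = -(1 / 2) ∧ ⟪A (u + s), n⟫_ℝ ≤ 0).image (fun s => b + A s)) ∪
          ((fccSlots.filter fun s => ⟪s, u⟫_ℝ = -(1 / 2) ∧ ⟪A (u + s), n⟫_ℝ < 0).image
            (fun s => b + (A s - (2 * ⟪A s, n⟫_ℝ) • n))))))
    (hd : ∀ κ, ∃ u ∈ fccSlots, d κ = F κ u)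
    (hdn : ∀ κ, ∃ m : EuclideanSpace ℝ (Fin 3), ‖m‖ = 1 ∧
      (∀ w ∈ fccSlots, ⟪F κ w, m⟫_ℝ = 0 ∨ ⟪F κ w, m⟫_ℝ = Real.sqrt (2 / 3) ∨ ⟪F κ w, m⟫_ℝ = -Real.sqrt (2 / 3)) ∧
      ⟪d κ, m⟫_ℝ = Real.sqrt (2 / 3))
    (hmirror : ∀ κ (m : EuclideanSpace ℝ (Fin 3)), ‖m‖ = 1 →
      (∀ w ∈ fccSlots, ⟪F κ w, m⟫_ℝ = 0 ∨ ⟪F κ w, m⟫_ℝ = Real.sqrt (2 / 3) ∨ ⟪F κ w, m⟫_ℝ = -Real.sqrt (2 / 3)) →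
      ⟪d κ, m⟫_ℝ = Real.sqrt (2 / 3) → ∀ x, F (next κ m) x = F κ x - (2 * ⟪F κ x, m⟫_ℝ) • m)
    (hdnext : ∀ κ (m : EuclideanSpace ℝ (Fin 3)), ‖m‖ = 1 →
      (∀ w ∈ fccSlots, ⟪F κ w, m⟫_ℝ = 0 ∨ ⟪F κ w, m⟫_ℝ = Real.sqrt (2 / 3) ∨ ⟪F κ w, m⟫_ℝ = -Real.sqrt (2 / 3)) →
      ⟪d κ, m⟫_ℝ = Real.sqrt (2 / 3) → ⟪d (next κ m), m⟫_ℝ = Real.sqrt (2 / 3))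
    (hW : ∀ v, v ∈ W ↔ (v.1 ∈ X ∧
      (∃ a ∈ fccSlots, ∃ a' ∈ fccSlots, ∃ a'' ∈ fccSlots,
        ⟪a, a'⟫_ℝ = 1 / 2 ∧ ⟪a, a''⟫_ℝ = 1 / 2 ∧ ⟪a', a''⟫_ℝ = 1 / 2 ∧
        v.1 + F v.2 a ∈ X ∧ v.1 + F v.2 a' ∈ X ∧ v.1 + F v.2 a'' ∈ X) ∧
      v.1 - d v.2 ∈ X))
    (hf_full : ∀ v ∈ W, (∀ w ∈ fccSlots, v.1 + F v.2 w ∈ X) → f v = (v.1 + d v.2, v.2))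
    (hf_cross : ∀ v ∈ W, ∀ m : EuclideanSpace ℝ (Fin 3), ‖m‖ = 1 →
      (∀ w ∈ fccSlots, ⟪F v.2 w, m⟫_ℝ = 0 ∨ ⟪F v.2 w, m⟫_ℝ = Real.sqrt (2 / 3) ∨ ⟪F v.2 w, m⟫_ℝ = -Real.sqrt (2 / 3)) →
      (∀ w ∈ fccSlots, ⟪F v.2 w, m⟫_ℝ ≤ 0 → v.1 + F v.2 w ∈ X) →
      (∀ w ∈ fccSlots, ⟪F v.2 w, m⟫_ℝ < 0 → v.1 + (F v.2 w - (2 * ⟪F v.2 w, m⟫_ℝ) • m) ∈ X) →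
      (∀ w ∈ fccSlots, 0 < ⟪F v.2 w, m⟫_ℝ → v.1 + F v.2 w ∉ X) →
      ⟪d v.2, m⟫_ℝ = Real.sqrt (2 / 3) → f v = (v.1 + d (next v.2 m), next v.2 m))
    (hf_glide : ∀ v ∈ W, ∀ m : EuclideanSpace ℝ (Fin 3), ‖m‖ = 1 →
      (∀ w ∈ fccSlots, ⟪F v.2 w, m⟫_ℝ = 0 ∨ ⟪F v.2 w, m⟫_ℝ = Real.sqrt (2 / 3) ∨ ⟪F v.2 w, m⟫_ℝ = -Real.sqrt (2 / 3)) →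
      (∀ w ∈ fccSlots, ⟪F v.2 w, m⟫_ℝ ≤ 0 → v.1 + F v.2 w ∈ X) →
      (∀ w ∈ fccSlots, ⟪F v.2 w, m⟫_ℝ < 0 → v.1 + (F v.2 w - (2 * ⟪F v.2 w, m⟫_ℝ) • m) ∈ X) →
      (∀ w ∈ fccSlots, 0 < ⟪F v.2 w, m⟫_ℝ → v.1 + F v.2 w ∉ X) →
      ⟪d v.2, m⟫_ℝ = 0 → f v = (v.1 + d v.2, v.2))
    {v : EuclideanSpace ℝ (Fin 3) × K} (hv : v ∈ W)
    (hmov : (∀ w ∈ fccSlots, v.1 + F v.2 w ∈ X) ∨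
      ∃ m : EuclideanSpace ℝ (Fin 3), ‖m‖ = 1 ∧
        (∀ w ∈ fccSlots, ⟪F v.2 w, m⟫_ℝ = 0 ∨ ⟪F v.2 w, m⟫_ℝ = Real.sqrt (2 / 3) ∨ ⟪F v.2 w, m⟫_ℝ = -Real.sqrt (2 / 3)) ∧
        (∀ w ∈ fccSlots, ⟪F v.2 w, m⟫_ℝ ≤ 0 → v.1 + F v.2 w ∈ X) ∧
        (∀ w ∈ fccSlots, ⟪F v.2 w, m⟫_ℝ < 0 → v.1 + (F v.2 w - (2 * ⟪F v.2 w, m⟫_ℝ) • m) ∈ X) ∧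
        (∀ w ∈ fccSlots, 0 < ⟪F v.2 w, m⟫_ℝ → v.1 + F v.2 w ∉ X) ∧
        (⟪d v.2, m⟫_ℝ = Real.sqrt (2 / 3) ∨ ⟪d v.2, m⟫_ℝ = 0))
    (hend : ¬ ((∀ w ∈ fccSlots, (f v).1 + F (f v).2 w ∈ X) ∨
      ∃ m : EuclideanSpace ℝ (Fin 3), ‖m‖ = 1 ∧
        (∀ w ∈ fccSlots, ⟪F (f v).2 w, m⟫_ℝ = 0 ∨ ⟪F (f v).2 w, m⟫_ℝ = Real.sqrt (2 / 3) ∨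
          ⟪F (f v).2 w, m⟫_ℝ = -Real.sqrt (2 / 3)) ∧
        (∀ w ∈ fccSlots, ⟪F (f v).2 w, m⟫_ℝ ≤ 0 → (f v).1 + F (f v).2 w ∈ X) ∧
        (∀ w ∈ fccSlots, ⟪F (f v).2 w, m⟫_ℝ < 0 → (f v).1 + (F (f v).2 w - (2 * ⟪F (f v).2 w, m⟫_ℝ) • m) ∈ X) ∧
        (∀ w ∈ fccSlots, 0 < ⟪F (f v).2 w, m⟫_ℝ → (f v).1 + F (f v).2 w ∉ X) ∧
        (⟪d (f v).2, m⟫_ℝ = Real.sqrt (2 / 3) ∨ ⟪d (f v).2, m⟫_ℝ = 0))) :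
    (X.filter fun q => dist (f v).1 q = 1).card ≤ 11 := by
  have hvX : v.1 ∈ X := ((hW v).1 hv).1
  -- the target is certified: three independent occupied slots (its `60°` triangle)
  obtain ⟨hfvW, -, -⟩ := word_move_target hd hdn hmirror hdnext hW hf_full hf_cross hf_glide hv hmov
  obtain ⟨-, ⟨a, ha, a', ha', a'', ha'', i1, i2, i3, h1, h2, h3⟩, -⟩ := (hW _).1 hfvW
  have hind : LinearIndependent ℝ ![a, a', a''] := linearIndependent_of_pairwise_half ha ha' ha'' i1 i2 i3
  -- a trichotomy in the target's own frame contradicts `hend` unless `≤ 11`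
  have conclude :
      ((X.filter fun q => dist (f v).1 q = 1).card ≤ 11 ∨
        (∀ w ∈ fccSlots, (f v).1 + F (f v).2 w ∈ X) ∨
        ∃ n : EuclideanSpace ℝ (Fin 3), ‖n‖ = 1 ∧
          (∀ w ∈ fccSlots, ⟪F (f v).2 w, n⟫_ℝ = 0 ∨ ⟪F (f v).2 w, n⟫_ℝ = Real.sqrt (2 / 3) ∨
            ⟪F (f v).2 w, n⟫_ℝ = -Real.sqrt (2 / 3)) ∧
          (∀ w ∈ fccSlots, ⟪F (f v).2 w, n⟫_ℝ ≤ 0 → (f v).1 + F (f v).2 w ∈ X) ∧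
          (∀ w ∈ fccSlots, ⟪F (f v).2 w, n⟫_ℝ < 0 → (f v).1 + (F (f v).2 w - (2 * ⟪F (f v).2 w, n⟫_ℝ) • n) ∈ X) ∧
          (∀ w ∈ fccSlots, 0 < ⟪F (f v).2 w, n⟫_ℝ → (f v).1 + F (f v).2 w ∉ X) ∧
          (⟪d (f v).2, n⟫_ℝ = Real.sqrt (2 / 3) ∨ ⟪d (f v).2, n⟫_ℝ = 0)) →
      (X.filter fun q => dist (f v).1 q = 1).card ≤ 11 := by
    intro htri
    rcases htri with h11 | hall | ⟨n, hn, hmenu, hown, hmir, hfar, hdn'⟩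
    · exact h11
    · exact absurd (Or.inl hall) hend
    · exact absurd (Or.inr ⟨n, hn, hmenu, hown, hmir, hfar, hdn'⟩) hend
  rcases hmov with hfull | ⟨m, hm, hmenu, hown, hmir, hfar, hdm⟩
  · -- FULL move: closed C12 star at the target
    obtain ⟨u, hu, hdu, hpred, hstar⟩ := word_target_star_full hd hf_full hv hvX hfull
    exact conclude (word_target_le_eleven_or_moving hX hs₀ hcert hu hdu hpred hstar)
  · rcases hdm with hdm | hdm
    · -- CROSS move: closed C12 star of the new class
      obtain ⟨u, hu, hdu, hpred, hstar⟩ :=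
        word_target_star_cross hd hmirror hdnext hf_cross hv hvX hm hmenu hown hmir hfar hdm
      exact conclude (word_target_le_eleven_or_moving hX hs₀ hcert hu hdu hpred hstar)
    · -- GLIDE move: the A12 glide star at the target, in the unchanged frame `F κ`
      obtain ⟨u, hu, hdu⟩ := hd v.2
      obtain ⟨hfv, hpred, hownS, hmirS⟩ :=
        word_target_glide_star hf_glide hv hvX hm hmenu hown hmir hfar hu hdu hdm
      have hκ : (f v).2 = v.2 := by rw [hfv]
      have hum : ⟪F v.2 u, m⟫_ℝ = 0 := by rw [← hdu]; exact hdm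
      have hO := hcertA (F v.2) m hm hmenu u hu hum (f v).1
      have hOsub : insert ((f v).1 - F v.2 u)
          (((fccSlots.filter fun s => ⟪s, u⟫_ℝ = -(1 / 2) ∧ ⟪F v.2 (u + s), m⟫_ℝ ≤ 0).image
              (fun s => (f v).1 + F v.2 s)) ∪
            ((fccSlots.filter fun s => ⟪s, u⟫_ℝ = -(1 / 2) ∧ ⟪F v.2 (u + s), m⟫_ℝ < 0).image
              (fun s => (f v).1 + (F v.2 s - (2 * ⟪F v.2 s, m⟫_ℝ) • m)))) ⊆
          X.filter fun q => dist (f v).1 q = 1 := by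
        intro x hx
        rw [Finset.mem_insert, Finset.mem_union] at hx
        rw [Finset.mem_filter]
        rcases hx with rfl | hx | hx
        · refine ⟨hpred, ?_⟩
          rw [dist_eq_norm, sub_sub_cancel, LinearIsometryEquiv.norm_map, norm_eq_one_of_mem_fccSlots hu]
        · obtain ⟨s, hs, rfl⟩ := Finset.mem_image.1 hx
          obtain ⟨hsS, hsu, hle⟩ := Finset.mem_filter.1 hs
          refine ⟨hownS s hsS hsu hle, ?_⟩
          rw [dist_self_add_right, LinearIsometryEquiv.norm_map, norm_eq_one_of_mem_fccSlots hsS]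
        · obtain ⟨s, hs, rfl⟩ := Finset.mem_image.1 hx
          obtain ⟨hsS, hsu, hlt⟩ := Finset.mem_filter.1 hs
          refine ⟨hmirS s hsS hsu hlt, ?_⟩
          rw [dist_self_add_right, norm_sub_two_mul_inner_smul hm, LinearIsometryEquiv.norm_map,
            norm_eq_one_of_mem_fccSlots hsS]
      have h1' : (f v).1 + F v.2 a ∈ X := by rw [← hκ]; exact h1
      have h2' : (f v).1 + F v.2 a' ∈ X := by rw [← hκ]; exact h2
      have h3' : (f v).1 + F v.2 a'' ∈ X := by rw [← hκ]; exact h3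
      apply conclude
      rw [hκ, hdu]
      exact le_eleven_or_moving_of_exactOnly hX (F v.2) hOsub hO hu hpred ha ha' ha'' h1' h2' h3' hind

end Word

end Summit.Ventures.Crystal3D.Theorems

end
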